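import Summits.Ventures.PercRepro.SixFourPLMatch

/-!
# PercRepro — C-025 at `(6,4)`, §22.12.4 step (1): the cost bound `Σ_planes cost_g ≤ Σ_{𝒫(π)} cost_g` (p3, gen 10)

The planes of `M` with a rank-`3` trace are dominated type by type by the plane list (`sum_tyP_le`), `cost5`
depends only on the type (`cost5_ty`, `cost5_tyP`), the planes with a trace of rank `≤ 2` cost nothing
(`sum_cost_le`), and the third-kind entries `{x} ∪ λ` (`q ≤ 8`, one `(q − 1)`-line) have `cost_g ≥ 0` for `g ≥ 10`
(`cost5_xlEntry_nonneg`: `D₃ = ε(q − 1) ≥ C(q − 1, 3) = r₃₄` and `5(g − q) − 2 ≥ 8`).  Hence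
**`cost_profile_le`**: `5·Σ_{P ∈ planes M} cost_g(P) ≤ cost5sum(π)` for every normalisation `D` of a plane-line set
(`simple M`, `G ⊆ E`, plane traces `≤ 7`, `10 ≤ g`).
-/

namespace PercRepro.SixFour

open Finset ThmH

variable {α : Type*} [DecidableEq α] {M : Matroid α} [M.Finite] {G : Finset α}

namespace PL

/-- The small values of `δ` (in `PL`). -/
theorem delta_small : delta 2 = 0 ∧ delta 3 = 0 ∧ delta 4 = 1 ∧ delta 5 = 6 ∧ delta 6 = 22 ∧ delta 7 = 64 ∧
    delta 8 = 163 := by decide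

/-- The small values of `C(·,4)` (in `PL`). -/
theorem ch_four_small : ch 2 4 = 0 ∧ ch 3 4 = 0 ∧ ch 4 4 = 1 ∧ ch 5 4 = 5 ∧ ch 6 4 = 15 ∧ ch 7 4 = 35 ∧
    ch 8 4 = 70 := by decide

/-- **`cost_g ≥ 0` on the third-kind entries** for `g ≥ 10` and `i ≤ 5`. -/
theorem cost5_xlEntry_nonneg (π : CProf) (g : ℕ) (hg : 10 ≤ g) (i : ℕ) (hi : i ≤ 5) :
    0 ≤ cost5 g (xlEntry π i) := by
  have hg' : (10 : ℤ) ≤ g := by exact_mod_cast hg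
  obtain ⟨d2, d3, d4, d5, d6, d7, d8⟩ := delta_small
  obtain ⟨c2, c3, c4, c5, c6, c7, c8⟩ := ch_four_small
  unfold cost5 D3 r34 xlEntry
  interval_cases i <;>
    simp only [Nat.reduceAdd, Nat.reduceLT, ↓reduceIte, List.map_cons, List.map_nil, List.sum_cons, List.sum_nil,
      d2, d3, d4, d5, d6, d7, d8, c2, c3, c4, c5, c6, c7, c8] <;>
    push_cast <;> nlinarith [hg']

/-- Every entry of `planes π` is small when `n + e ≤ 7` and every class size is `≤ 7`. -/
theorem Small_of_mem_planes (π : CProf) (hn : π.n + e π ≤ 7) (hsz : ∀ s ∈ π.sizes, s ≤ 7) {Q : Pl}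
    (hQ : Q ∈ planes π) : Small Q := by
  rw [planes_eq] at hQ
  simp only [List.mem_append, List.mem_singleton, List.mem_map, List.mem_range] at hQ
  rcases hQ with (rfl | ⟨s, hs, rfl⟩) | ⟨i, hi, rfl⟩
  · exact Small_rhoEntry π
  · exact Small_piEntry π s hn (hsz s hs)
  · exact Small_xlEntry π i (by omega)

end PL

namespace PLData

variable {D : PLData M G}

/-- Every entry of the plane list of a normalisation is small. -/
theorem Small_planes (hs : Simple M) (hG : G ⊆ gr M) (hpl : ∀ P ∈ planes M, (P ∩ G).card ≤ 7) (hg : 10 ≤ G.card)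
    {Q : PL.Pl} (hQ : Q ∈ PL.planes D.profile) : PL.Small Q := by
  obtain ⟨hne, -, -, hn3, -⟩ := size_facts (D := D) hs hG hpl hg
  have h2 : 2 ≤ D.L.card := by omega
  refine PL.Small_of_mem_planes D.profile ?_ ?_ hQ
  · rw [e_profile_eq hs hG h2]
    show D.L.card + (D.ellF ∩ D.ρ).card ≤ 7
    omega
  · intro s hs'
    obtain ⟨y, hy, rfl⟩ := mem_sizes.1 hs'
    have := card_lam_add_card_L_le hs hG h2 hpl hy
    omega

/-- **Step (1) of 22.12.4**: `5·Σ_{P ∈ planes M} cost_g(P) ≤ cost5sum(π)`. -/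
theorem cost_profile_le (hs : Simple M) (hG : G ⊆ gr M) (hpl : ∀ P ∈ planes M, (P ∩ G).card ≤ 7)
    (hg : 10 ≤ G.card) : 5 * ∑ P ∈ planes M, cost M G P ≤ (PL.cost5sum D.profile : ℚ) := by
  have h1 : 5 * ∑ P ∈ planes M, cost M G P ≤ 5 * ∑ P ∈ planesR3 M G, cost M G P :=
    mul_le_mul_of_nonneg_left (sum_cost_le G) (by norm_num)
  have h2 : 5 * ∑ P ∈ planesR3 M G, cost M G P = ∑ P ∈ planesR3 M G, (PL.cost5 G.card (tyP M G P) : ℚ) := by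
    rw [Finset.mul_sum]
    refine Finset.sum_congr rfl (fun P hP => ?_)
    obtain ⟨hP, hr3⟩ := mem_planesR3.1 hP
    rw [cost5_tyP hs hG (hpl P hP) hr3]
  have h3 : ∑ P ∈ planesR3 M G, (PL.cost5 G.card (tyP M G P) : ℚ) ≤
      ((PL.planes D.profile).map fun Q => (Q.mult : ℚ) * (PL.cost5 G.card (PL.ty Q) : ℚ)).sum :=
    sum_tyP_le hs hG hpl hg (fun Q => (PL.cost5 G.card Q : ℚ)) (fun i hi => by
      rw [PL.cost5_ty _ _ (PL.Small_xlEntry _ i (by omega))]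
      exact_mod_cast PL.cost5_xlEntry_nonneg D.profile G.card hg i (by omega))
  have h4 : ((PL.planes D.profile).map fun Q => (Q.mult : ℚ) * (PL.cost5 G.card (PL.ty Q) : ℚ)).sum =
      (PL.cost5sum D.profile : ℚ) := by
    unfold PL.cost5sum
    rw [g_profile]
    push_cast
    rw [List.map_map]
    refine congrArg List.sum (List.map_congr_left (fun Q hQ => ?_))
    simp only [Function.comp_apply, Int.cast_mul, Int.cast_natCast]
    rw [PL.cost5_ty _ _ (Small_planes hs hG hpl hg hQ)]
  linarith [h1, h2, h3, h4]

end PLData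

end PercRepro.SixFour
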